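import Mathlib.LinearAlgebra.Projectivization.Basic
import Mathlib.Geometry.Manifold.IsManifold.Basic
import Mathlib.Analysis.Normed.Field.Basic
import Mathlib.Analysis.Complex.Basic
import Mathlib.RingTheory.MvPolynomial.Homogeneous
import Mathlib.Topology.Algebra.MvPolynomial
import Mathlib.Topology.Algebra.Module.FiniteDimension
import Mathlib.Analysis.Calculus.ContDiff.Operations
import Summits.Ventures.HodgeRepro2.HostAPI.Util.ForallBinderLint

noncomputable section

open scoped LinearAlgebra.Projectivization Manifold ContDiff
open Set Function Topology

namespace HostAPI.Carriers.Projectivization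
open HostAPI.Carriers _root_.Projectivization

section Topology

variable {𝕜 : Type*} [DivisionRing 𝕜] {W : Type*} [AddCommGroup W] [Module 𝕜 W]
  [TopologicalSpace W]

instance instTopologicalSpace : TopologicalSpace (ℙ 𝕜 W) :=
  inferInstanceAs (TopologicalSpace (Quotient (projectivizationSetoid 𝕜 W)))

theorem isQuotientMap_mk :
    IsQuotientMap (fun v : {v : W // v ≠ 0} ↦ Projectivization.mk 𝕜 v.1 v.2) :=
  isQuotientMap_quotient_mk'

theorem continuous_mk :
    Continuous (fun v : {v : W // v ≠ 0} ↦ Projectivization.mk 𝕜 v.1 v.2) :=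
  isQuotientMap_mk.continuous

theorem continuous_mk' : Continuous (Projectivization.mk' 𝕜 : {v : W // v ≠ 0} → ℙ 𝕜 W) :=
  continuous_mk

variable [ContinuousConstSMul 𝕜 W]

theorem isOpenMap_mk :
    IsOpenMap (fun v : {v : W // v ≠ 0} ↦ Projectivization.mk 𝕜 v.1 v.2) := by
  intro U hU
  rw [← isQuotientMap_mk.isCoinducing.isOpen_preimage]
  have key : (fun v : {v : W // v ≠ 0} ↦ Projectivization.mk 𝕜 v.1 v.2) ⁻¹'
      ((fun v : {v : W // v ≠ 0} ↦ Projectivization.mk 𝕜 v.1 v.2) '' U) =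
      ⋃ a : 𝕜ˣ, (fun v : {v : W // v ≠ 0} ↦
        (⟨(a : 𝕜) • v.1, smul_ne_zero a.ne_zero v.2⟩ : {v : W // v ≠ 0})) ⁻¹' U := by
    ext v
    simp only [mem_preimage, mem_image, mem_iUnion, mk_eq_mk_iff]
    constructor
    · rintro ⟨u, hu, a, ha⟩
      refine ⟨a, ?_⟩
      have hau : (⟨(a : 𝕜) • v.1, smul_ne_zero a.ne_zero v.2⟩ : {v : W // v ≠ 0}) = u :=
        Subtype.ext (by simpa [Units.smul_def] using ha)
      rwa [hau]
    · rintro ⟨a, ha⟩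
      exact ⟨_, ha, a, rfl⟩
  rw [key]
  exact isOpen_iUnion fun a ↦ hU.preimage (by fun_prop)

theorem isOpenQuotientMap_mk :
    IsOpenQuotientMap (fun v : {v : W // v ≠ 0} ↦ Projectivization.mk 𝕜 v.1 v.2) :=
  ⟨isQuotientMap_mk.surjective, continuous_mk, isOpenMap_mk⟩

end Topology

section Charts

variable {𝕜 : Type*} [Field 𝕜] {n : ℕ}

def stdChartFun (i : Fin (n + 1)) (p : ℙ 𝕜 (Fin (n + 1) → 𝕜)) : Fin n → 𝕜 :=
  fun j ↦ p.rep (i.succAbove j) / p.rep i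

theorem insertNth_one_ne_zero (i : Fin (n + 1)) (w : Fin n → 𝕜) :
    (Fin.insertNth i (1 : 𝕜) w : Fin (n + 1) → 𝕜) ≠ 0 := by
  intro h
  have := congrFun h i
  simp at this

def stdChartInv (i : Fin (n + 1)) (w : Fin n → 𝕜) : ℙ 𝕜 (Fin (n + 1) → 𝕜) :=
  Projectivization.mk 𝕜 (Fin.insertNth i 1 w) (insertNth_one_ne_zero i w)

def stdChartSource (i : Fin (n + 1)) : Set (ℙ 𝕜 (Fin (n + 1) → 𝕜)) :=
  {p | p.rep i ≠ 0}

@[simp]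
theorem mk_mem_stdChartSource_iff (i : Fin (n + 1)) (v : Fin (n + 1) → 𝕜) (hv : v ≠ 0) :
    Projectivization.mk 𝕜 v hv ∈ stdChartSource i ↔ v i ≠ 0 := by
  obtain ⟨a, ha⟩ := exists_smul_eq_mk_rep 𝕜 v hv
  simp only [stdChartSource, mem_setOf_eq, ← ha, Pi.smul_apply, Units.smul_def, smul_eq_mul]
  exact (mul_ne_zero_iff_left a.ne_zero)

@[simp]
theorem stdChartFun_mk (i : Fin (n + 1)) (v : Fin (n + 1) → 𝕜) (hv : v ≠ 0) :
    stdChartFun i (Projectivization.mk 𝕜 v hv) = fun j ↦ v (i.succAbove j) / v i := by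
  obtain ⟨a, ha⟩ := exists_smul_eq_mk_rep 𝕜 v hv
  ext j
  simp only [stdChartFun, ← ha, Pi.smul_apply, Units.smul_def, smul_eq_mul,
    mul_div_mul_left _ _ a.ne_zero]

theorem stdChartInv_mem_stdChartSource (i : Fin (n + 1)) (w : Fin n → 𝕜) :
    stdChartInv i w ∈ stdChartSource i := by
  simp [stdChartInv]

@[simp]
theorem stdChartFun_stdChartInv (i : Fin (n + 1)) (w : Fin n → 𝕜) :
    stdChartFun i (stdChartInv i w) = w := by
  ext j
  simp [stdChartInv]

theorem stdChartInv_stdChartFun (i : Fin (n + 1)) {p : ℙ 𝕜 (Fin (n + 1) → 𝕜)}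
    (hp : p ∈ stdChartSource i) : stdChartInv i (stdChartFun i p) = p := by
  induction p with
  | h v hv =>
    rw [mk_mem_stdChartSource_iff] at hp
    rw [stdChartFun_mk, stdChartInv, mk_eq_mk_iff']
    refine ⟨(v i)⁻¹, funext fun k ↦ ?_⟩
    refine Fin.succAboveCases i ?_ (fun j ↦ ?_) k
    · simp [hp]
    · simp [div_eq_inv_mul]

end Charts

section ChartedSpace

variable {𝕜 : Type*} [NontriviallyNormedField 𝕜] {n : ℕ}

theorem continuous_subtype_val_apply (i : Fin (n + 1)) :
    Continuous fun v : {v : Fin (n + 1) → 𝕜 // v ≠ 0} ↦ v.1 i :=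
  (continuous_apply i).comp continuous_subtype_val

theorem isOpen_setOf_subtype_val_apply_ne_zero (i : Fin (n + 1)) :
    IsOpen {v : {v : Fin (n + 1) → 𝕜 // v ≠ 0} | v.1 i ≠ 0} :=
  isOpen_ne_fun (continuous_subtype_val_apply i) continuous_const

theorem isOpen_stdChartSource (i : Fin (n + 1)) :
    IsOpen (stdChartSource i : Set (ℙ 𝕜 (Fin (n + 1) → 𝕜))) := by
  rw [← isQuotientMap_mk.isCoinducing.isOpen_preimage]
  have : (fun v : {v : Fin (n + 1) → 𝕜 // v ≠ 0} ↦ Projectivization.mk 𝕜 v.1 v.2) ⁻¹'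
      stdChartSource i = {v | v.1 i ≠ 0} := by
    ext v
    simp
  rw [this]
  exact isOpen_setOf_subtype_val_apply_ne_zero i

theorem continuousOn_stdChartFun (i : Fin (n + 1)) :
    ContinuousOn (stdChartFun i : ℙ 𝕜 (Fin (n + 1) → 𝕜) → Fin n → 𝕜) (stdChartSource i) := by
  rw [continuousOn_open_iff (isOpen_stdChartSource i)]
  intro t ht
  rw [← isQuotientMap_mk.isCoinducing.isOpen_preimage]
  set g : {v : Fin (n + 1) → 𝕜 // v ≠ 0} → Fin n → 𝕜 :=
    fun v j ↦ v.1 (i.succAbove j) / v.1 i with hg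
  have hgc : ContinuousOn g {v | v.1 i ≠ 0} := by
    refine continuousOn_pi.2 fun j ↦ ?_
    exact ContinuousOn.div (continuous_subtype_val_apply _).continuousOn
      (continuous_subtype_val_apply i).continuousOn fun v hv ↦ hv
  have : (fun v : {v : Fin (n + 1) → 𝕜 // v ≠ 0} ↦ Projectivization.mk 𝕜 v.1 v.2) ⁻¹'
      (stdChartSource i ∩ stdChartFun i ⁻¹' t) = {v | v.1 i ≠ 0} ∩ g ⁻¹' t := by
    ext v
    simp [hg]
  rw [this]
  exact (continuousOn_open_iff (isOpen_setOf_subtype_val_apply_ne_zero i)).1 hgc t ht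

theorem continuous_stdChartInv (i : Fin (n + 1)) :
    Continuous (stdChartInv i : (Fin n → 𝕜) → ℙ 𝕜 (Fin (n + 1) → 𝕜)) := by
  have h : Continuous fun w : Fin n → 𝕜 ↦
      (⟨Fin.insertNth i 1 w, insertNth_one_ne_zero i w⟩ : {v : Fin (n + 1) → 𝕜 // v ≠ 0}) :=
    Continuous.subtype_mk (Continuous.finInsertNth (A := fun _ ↦ 𝕜) i
      (continuous_const (y := (1 : 𝕜))) continuous_id) _
  exact continuous_mk.comp h

def stdChart (i : Fin (n + 1)) : OpenPartialHomeomorph (ℙ 𝕜 (Fin (n + 1) → 𝕜)) (Fin n → 𝕜) where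
  toFun := stdChartFun i
  invFun := stdChartInv i
  source := stdChartSource i
  target := univ
  map_source' _ _ := mem_univ _
  map_target' w _ := stdChartInv_mem_stdChartSource i w
  left_inv' _ hp := stdChartInv_stdChartFun i hp
  right_inv' w _ := stdChartFun_stdChartInv i w
  open_source := isOpen_stdChartSource i
  open_target := isOpen_univ
  continuousOn_toFun := continuousOn_stdChartFun i
  continuousOn_invFun := (continuous_stdChartInv i).continuousOn

@[simp]
theorem stdChart_apply (i : Fin (n + 1)) (p : ℙ 𝕜 (Fin (n + 1) → 𝕜)) :
    stdChart i p = stdChartFun i p := rfl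

@[simp]
theorem stdChart_symm_apply (i : Fin (n + 1)) (w : Fin n → 𝕜) :
    (stdChart i).symm w = stdChartInv i w := rfl

@[simp]
theorem stdChart_source (i : Fin (n + 1)) :
    (stdChart i : OpenPartialHomeomorph (ℙ 𝕜 (Fin (n + 1) → 𝕜)) (Fin n → 𝕜)).source =
      stdChartSource i := rfl

@[simp]
theorem stdChart_target (i : Fin (n + 1)) :
    (stdChart i : OpenPartialHomeomorph (ℙ 𝕜 (Fin (n + 1) → 𝕜)) (Fin n → 𝕜)).target = univ :=
  rfl

theorem exists_rep_apply_ne_zero (p : ℙ 𝕜 (Fin (n + 1) → 𝕜)) : ∃ i, p.rep i ≠ 0 :=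
  Function.ne_iff.1 p.rep_nonzero

instance instChartedSpace : ChartedSpace (Fin n → 𝕜) (ℙ 𝕜 (Fin (n + 1) → 𝕜)) where
  atlas := range stdChart
  chartAt p := stdChart (Classical.choose (exists_rep_apply_ne_zero p))
  mem_chart_source p := Classical.choose_spec (exists_rep_apply_ne_zero p)
  chart_mem_atlas _ := mem_range_self _

theorem chartAt_eq (p : ℙ 𝕜 (Fin (n + 1) → 𝕜)) :
    chartAt (Fin n → 𝕜) p = stdChart (Classical.choose (exists_rep_apply_ne_zero p)) := rfl

end ChartedSpace

section Algebraic

variable {𝕜 : Type*} [Field 𝕜] {ι : Type*}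

def projZeroLocus (S : Set (MvPolynomial ι 𝕜)) : Set (ℙ 𝕜 (ι → 𝕜)) :=
  {p | ∀ F ∈ S, MvPolynomial.eval p.rep F = 0}

theorem eval_smul_of_isHomogeneous {F : MvPolynomial ι 𝕜} {d : ℕ}
    (hF : F.IsHomogeneous d) (c : 𝕜) (z : ι → 𝕜) :
    MvPolynomial.eval (c • z) F = c ^ d * MvPolynomial.eval z F := by
  simp only [MvPolynomial.eval_eq, Finset.mul_sum]
  refine Finset.sum_congr rfl fun s hs => ?_
  have hd : s.degree = d := by
    by_contra h
    exact (MvPolynomial.mem_support_iff.mp hs) (hF.coeff_eq_zero h)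
  subst hd
  simp only [Pi.smul_apply, smul_eq_mul, mul_pow, Finset.prod_mul_distrib,
    Finset.prod_pow_eq_pow_sum, Finsupp.degree_apply]
  ring

theorem mem_projZeroLocus_mk_iff {S : Set (MvPolynomial ι 𝕜)}
    (hS : ∀ F ∈ S, F.IsHomogeneous F.totalDegree) (v : ι → 𝕜) (hv : v ≠ 0) :
    Projectivization.mk 𝕜 v hv ∈ projZeroLocus S ↔ ∀ F ∈ S, MvPolynomial.eval v F = 0 := by
  obtain ⟨a, ha⟩ := exists_smul_eq_mk_rep 𝕜 v hv
  simp only [projZeroLocus, mem_setOf_eq, ← ha]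
  refine forall₂_congr fun F hF ↦ ?_
  rw [Units.smul_def, eval_smul_of_isHomogeneous (hS F hF), mul_eq_zero,
    or_iff_right (pow_ne_zero _ a.ne_zero)]

theorem projZeroLocus_union (S T : Set (MvPolynomial ι 𝕜)) :
    projZeroLocus (S ∪ T) = projZeroLocus S ∩ projZeroLocus T := by
  ext p
  simp only [projZeroLocus, mem_setOf_eq, mem_union, or_imp, forall_and, mem_inter_iff]

@[simp]
theorem projZeroLocus_empty : projZeroLocus (∅ : Set (MvPolynomial ι 𝕜)) = univ := by
  simp [projZeroLocus]

@[simp]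
theorem projZeroLocus_one : projZeroLocus ({1} : Set (MvPolynomial ι 𝕜)) = ∅ := by
  simp [projZeroLocus]

def conePreimage {W : Type*} [AddCommGroup W] [Module 𝕜 W] (Z : Set (ℙ 𝕜 W)) : Set W :=
  {0} ∪ {v | ∃ h : v ≠ 0, Projectivization.mk 𝕜 v h ∈ Z}

section Cone

variable {W : Type*} [AddCommGroup W] [Module 𝕜 W]

@[simp]
theorem zero_mem_conePreimage (Z : Set (ℙ 𝕜 W)) : (0 : W) ∈ conePreimage Z := by
  simp [conePreimage]

theorem mem_conePreimage_iff {Z : Set (ℙ 𝕜 W)} {v : W} (hv : v ≠ 0) :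
    v ∈ conePreimage Z ↔ Projectivization.mk 𝕜 v hv ∈ Z := by
  simp [conePreimage, hv]

theorem smul_mem_conePreimage {Z : Set (ℙ 𝕜 W)} (c : 𝕜) {v : W} (hv : v ∈ conePreimage Z) :
    c • v ∈ conePreimage Z := by
  by_cases hc : c = 0
  · simp [hc]
  by_cases hv0 : v = 0
  · simp [hv0]
  rw [mem_conePreimage_iff hv0] at hv
  rw [mem_conePreimage_iff (smul_ne_zero hc hv0)]
  convert hv using 1
  exact (mk_eq_mk_iff' 𝕜 _ _ _ _).2 ⟨c, rfl⟩

end Cone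

theorem conePreimage_projZeroLocus {S : Set (MvPolynomial ι 𝕜)}
    (hS : ∀ F ∈ S, F.IsHomogeneous F.totalDegree) :
    conePreimage (projZeroLocus S) = {0} ∪ {v | ∀ F ∈ S, MvPolynomial.eval v F = 0} := by
  ext v
  by_cases hv : v = 0
  · simp [hv, conePreimage]
  · simp [conePreimage, hv, mem_projZeroLocus_mk_iff hS]

theorem conePreimage_projZeroLocus_of_nonempty {S : Set (MvPolynomial ι 𝕜)}
    (hS : ∀ F ∈ S, F.IsHomogeneous F.totalDegree) (hne : (projZeroLocus S).Nonempty) :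
    conePreimage (projZeroLocus S) = {v | ∀ F ∈ S, MvPolynomial.eval v F = 0} := by
  rw [conePreimage_projZeroLocus hS, union_eq_right, singleton_subset_iff, mem_setOf_eq]
  intro F hF
  obtain ⟨p, hp⟩ := hne
  induction p with
  | h v hv =>
    have h := (mem_projZeroLocus_mk_iff hS v hv).1 hp F hF
    have := eval_smul_of_isHomogeneous (hS F hF) 0 v
    rw [zero_smul] at this
    rw [this, h, mul_zero]

end Algebraic

section AlgebraicTopology

variable {𝕜 : Type*} [NontriviallyNormedField 𝕜] {ι : Type*}

theorem isClosed_projZeroLocus {S : Set (MvPolynomial ι 𝕜)}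
    (hS : ∀ F ∈ S, F.IsHomogeneous F.totalDegree) : IsClosed (projZeroLocus S) := by
  rw [← isQuotientMap_mk.isCoinducing.isClosed_preimage]
  have : (fun v : {v : ι → 𝕜 // v ≠ 0} ↦ Projectivization.mk 𝕜 v.1 v.2) ⁻¹' projZeroLocus S =
      ⋂ F ∈ S, {v | MvPolynomial.eval v.1 F = 0} := by
    ext v
    simp [mem_projZeroLocus_mk_iff hS]
  rw [this]
  exact isClosed_biInter fun F _ ↦
    isClosed_eq ((MvPolynomial.continuous_eval F).comp continuous_subtype_val) continuous_const

end AlgebraicTopology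

end HostAPI.Carriers.Projectivization
open HostAPI.Carriers

namespace HostAPI.Carriers.NumberTheory.Transcendental

open _root_.Projectivization HostAPI.Carriers.Projectivization

section Global

variable (𝕜 : Type*) [NontriviallyNormedField 𝕜] (n : ℕ)

def isManifold_projectivization : Prop :=
  IsManifold 𝓘(𝕜, Fin n → 𝕜) ω (ℙ 𝕜 (Fin (n + 1) → 𝕜))

def t2Space_projectivization : Prop :=
  T2Space (ℙ 𝕜 (Fin (n + 1) → 𝕜))

def compactSpace_projectivization : Prop :=
  ∀ [ProperSpace 𝕜],
    CompactSpace (ℙ 𝕜 (Fin (n + 1) → 𝕜))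

def secondCountableTopology_projectivization : Prop :=
  ∀ [SecondCountableTopology 𝕜],
    SecondCountableTopology (ℙ 𝕜 (Fin (n + 1) → 𝕜))

def connectedSpace_projectivization : Prop :=
  ConnectedSpace (ℙ ℂ (Fin (n + 1) → ℂ))

end Global

section ProjAlgebraic

variable {𝕜 : Type*} [Field 𝕜] {ι : Type*}

def IsProjAlgebraicSet (Z : Set (ℙ 𝕜 (ι → 𝕜))) : Prop :=
  ∃ S : Finset (MvPolynomial ι 𝕜),
    (∀ F ∈ S, F.IsHomogeneous F.totalDegree) ∧ Z = projZeroLocus (↑S : Set (MvPolynomial ι 𝕜))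

theorem isProjAlgebraicSet_empty : IsProjAlgebraicSet (∅ : Set (ℙ 𝕜 (ι → 𝕜))) :=
  ⟨{1}, by simp [MvPolynomial.isHomogeneous_one], by simp⟩

theorem isProjAlgebraicSet_univ : IsProjAlgebraicSet (univ : Set (ℙ 𝕜 (ι → 𝕜))) :=
  ⟨∅, by simp, by simp⟩

theorem IsProjAlgebraicSet.inter {Z₁ Z₂ : Set (ℙ 𝕜 (ι → 𝕜))}
    (h₁ : IsProjAlgebraicSet Z₁) (h₂ : IsProjAlgebraicSet Z₂) : IsProjAlgebraicSet (Z₁ ∩ Z₂) := by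
  classical
  obtain ⟨S, hS, rfl⟩ := h₁
  obtain ⟨T, hT, rfl⟩ := h₂
  refine ⟨S ∪ T, fun F hF ↦ ?_, ?_⟩
  · rcases Finset.mem_union.1 hF with h | h
    exacts [hS F h, hT F h]
  · rw [Finset.coe_union, projZeroLocus_union]

theorem IsProjAlgebraicSet.union {Z₁ Z₂ : Set (ℙ 𝕜 (ι → 𝕜))}
    (h₁ : IsProjAlgebraicSet Z₁) (h₂ : IsProjAlgebraicSet Z₂) : IsProjAlgebraicSet (Z₁ ∪ Z₂) := by
  classical
  obtain ⟨S, hS, rfl⟩ := h₁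
  obtain ⟨T, hT, rfl⟩ := h₂
  refine ⟨(S ×ˢ T).image fun FG ↦ FG.1 * FG.2, fun H hH ↦ ?_, ?_⟩
  · obtain ⟨⟨F, G⟩, hFG, rfl⟩ := Finset.mem_image.1 hH
    obtain ⟨hF, hG⟩ := Finset.mem_product.1 hFG
    have hmul := (hS F hF).mul (hT G hG)
    by_cases h0 : F * G = 0
    · simp only [h0]
      exact MvPolynomial.isHomogeneous_zero _ _ _
    · rwa [hmul.totalDegree h0]
  · ext p
    simp only [mem_union, projZeroLocus, mem_setOf_eq, Finset.coe_image, Finset.coe_product,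
      mem_image, mem_prod, Prod.exists, forall_exists_index, and_imp]
    constructor
    · rintro (h | h) H F G hF hG rfl
      · simp [h F hF]
      · simp [h G hG]
    · intro h
      by_contra hcon
      simp only [not_or, not_forall, exists_prop] at hcon
      obtain ⟨⟨F, hF, hF0⟩, ⟨G, hG, hG0⟩⟩ := hcon
      have := h (F * G) F G hF hG rfl
      rw [map_mul, mul_eq_zero] at this
      exact this.elim hF0 hG0

end ProjAlgebraic

section ProjAlgebraicTopology

variable {𝕜 : Type*} [NontriviallyNormedField 𝕜] {ι : Type*}

theorem IsProjAlgebraicSet.isClosed {Z : Set (ℙ 𝕜 (ι → 𝕜))} (hZ : IsProjAlgebraicSet Z) :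
    IsClosed Z := by
  obtain ⟨S, hS, rfl⟩ := hZ
  exact isClosed_projZeroLocus hS

end ProjAlgebraicTopology

end HostAPI.Carriers.NumberTheory.Transcendental

namespace HostAPI.Carriers.Projectivization
open HostAPI.Carriers _root_.Projectivization

section Compact

variable {𝕜 : Type*} [NontriviallyNormedField 𝕜] {W : Type*} [NormedAddCommGroup W]
  [NormedSpace 𝕜 W]

theorem compactSpace_of_properSpace [ProperSpace W] : CompactSpace (ℙ 𝕜 W) := by
  obtain ⟨c, hc⟩ := NormedField.exists_one_lt_norm 𝕜
  have hc0 : 0 < 1 / ‖c‖ := div_pos one_pos (one_pos.trans hc)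
  set K : Set W := {v | 1 / ‖c‖ ≤ ‖v‖ ∧ ‖v‖ ≤ 1}
  have hKc : IsCompact K := by
    refine (isCompact_closedBall (0 : W) 1).of_isClosed_subset ?_ fun v hv ↦ ?_
    · exact (isClosed_le continuous_const continuous_norm).inter
        (isClosed_le continuous_norm continuous_const)
    · simpa only [mem_closedBall_zero_iff] using hv.2
  have hK0 : ∀ v ∈ K, v ≠ 0 := fun v hv ↦ norm_pos_iff.mp (hc0.trans_le hv.1)
  haveI : CompactSpace K := isCompact_iff_compactSpace.mp hKc
  let f : K → ℙ 𝕜 W := fun v ↦ Projectivization.mk 𝕜 (v : W) (hK0 v v.2)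
  have hf : Continuous f :=
    continuous_mk.comp (continuous_subtype_val.subtype_mk fun v : K ↦ hK0 v v.2)
  refine Function.Surjective.compactSpace hf fun p ↦ ?_
  induction p with
  | h v hv =>
    obtain ⟨d, -, h1, h2, -⟩ := rescale_to_shell hc one_pos hv
    exact ⟨⟨d • v, h2, h1.le⟩, (mk_eq_mk_iff' 𝕜 _ _ _ _).2 ⟨d, rfl⟩⟩

end Compact

end HostAPI.Carriers.Projectivization

namespace HostAPI.Carriers.NumberTheory.Transcendental

theorem compactSpace_projectivization_holds (𝕜 : Type*) [NontriviallyNormedField 𝕜] (n : ℕ) :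
    compactSpace_projectivization 𝕜 n := by
  intro _
  exact Projectivization.compactSpace_of_properSpace

end HostAPI.Carriers.NumberTheory.Transcendental
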